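import Literature.InformationTheory.QuantumCodes.DrawnCheckMatrixSpaceTime
import Literature.InformationTheory.QuantumCodes.RotatedSurfaceCodeCrossingPaths
import HarnessLib

/-!
# The rotated surface code as a check matrix drawn on `ℤ²` (`H_X` sector, ALL faces), and its space-time counting bound
# under noisy syndrome measurement: `Prob[odd column-0 projected residual] ≤ L·T·C·r^L/(1-r)` with `cₙ(ℤ³) ≤ C νⁿ`

Topic `Literature/InformationTheory/QuantumCodes` (venture QEC, LADDER-QEC rung Q5, PARTITION row 09 "phenomenological";
qec-type-09 gen 7, cell item «09.RSCPH»). All PROVED, kernel axioms, no named fact. `RotatedSurfaceCodeLift.lean` (gen 6) draws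
the `X`-check graph of type-08's `RSC(L)` on the diagonal square lattice (valid faces `(a', b)`, `a' + b` odd, at
`rsite (a', b) = ((a'+b-1)/2, (a'-b-1)/2)`; qubit `(i, j)` as the unit bond `qbond (i, j)` whose ends have `u - v ∈ {j-1, j}`;
rough edges `u - v = -1` (`vbot i`) and `u - v = L-1` (`vtop i`)). This file packages that geometry as a `CheckDrawing` of the
WHOLE matrix `HX L` (`DrawnCheckMatrixCrossingPaths.lean`), zero rows included: the faces of the wrong colour are parked at
`fsite (a', b) = (a', a'+b+2)`, off the strip `-1 ≤ u - v ≤ L-1`, so that INCIDENCE = GEOMETRY holds for every row — which is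
what the space-time lift needs (the measurement faults of zero-row faces are genuine fault locations of lit-2's model).

* `endLo`, `endHi`, `qbond_eq`, `endLo_sub`, `endHi_sub`, `exists_rsite_eq_endLo/Hi`, `endLo_eq_vbot`, `endHi_eq_vtop` —
  the two ends of the bond of the qubit `(i, j)` (`u - v = j-1` resp. `j`) and what they are: the site of a valid face, or
  `vbot i` (when `j = 0`), or `vtop i` (when `j = L-1`);
* `fsite`, `fsite_injective`, ★ `rscDrawing L : CheckDrawing (HX L) 2 (Fin L) (Fin L)` with `bot (i, j) = [j = 0]`;
  `rscDrawing_heightGap : HeightGap L` (height `u - v`), `sum_mul_rscDrawing_bot` (`Σ_q c(q)·bot(q) = Σ_i c(i, 0)`);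
* ★ `rsc_st_sum_oddResidual_le_twoRate` / `rsc_st_sum_oddResidual_le` — for `L ≥ 1`, `T` noisy rounds with rates
  `p, q ≤ ρ ≤ 1/2` (resp. `q = p`), a minimum-weight SPACE-TIME decoder of the `H_X` sector and `cₙ(ℤ³) ≤ C νⁿ`
  (`ToricCode.SAWCountBound3 C ν`), `r = 2ν√(ρ(1-ρ)) < 1`: the total probability of the histories whose residual projects to
  a chain with an odd number of column-`0` qubits is `≤ L·T·C·r^L/(1-r)` (the generic space-time lift
  `CheckDrawing.spaceTime`, DKLP eq. (fail_iso) in relative form); `rsc_st_tendsto_sum_oddResidual(_twoRate)` — it tends to `0`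
  along `L = i + 1` for polynomially many rounds when `4ν² ρ(1-ρ) < 1`.

## References

* [DennisEtAl2002] E. Dennis, A. Kitaev, A. Landahl, J. Preskill, *Topological quantum memory*, J. Math. Phys. 43 (2002)
  4452–4505, arXiv:quant-ph/0110143, §3.2 (rough edges), §4.2–4.3 (space-time lattice, syndrome = boundary), §5.2–5.3
  (eqs. (e_ineq), (saw_L), (saw_3), (threshold_iso), (fail_iso); relative polygons of planar codes).
* [TomitaSvore2014] Y. Tomita, K. M. Svore, PRA 90 (2014) 062320, §2.2 (the rotated layout, Surface-17).
-/

namespace Literature.InformationTheory.QuantumCodes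

namespace RotatedSurface

open Finset Matrix Filter Topology CSSPhenom
open Literature.Probability.LatticeModels (Site zdGraph)
open Literature.Probability.RandomPlanarGeometry

variable {L : ℕ}

/-- Sites are determined by their coordinates. [folklore] -/
private theorem spt_eq_spt_iff'' {u v u' v' : ℤ} : spt u v = spt u' v' ↔ u = u' ∧ v = v' := by
  refine ⟨fun h => ?_, by rintro ⟨rfl, rfl⟩; rfl⟩
  exact ⟨by simpa [spt] using congrFun h 0, by simpa [spt] using congrFun h 1⟩

/-- Coordinates of `spt`. [folklore] -/
private theorem spt_sub (u v : ℤ) : spt u v 0 - spt u v 1 = u - v := by simp [spt]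

/-! ### The two ends of the bond of a qubit -/

/-- **The lower end** of the bond of the qubit `(i, j)` (the end with `u - v = j - 1`): `((i+j)/2 - 1, (i-j)/2)` if `i + j` is
even, `((i+j-1)/2, (i-j-1)/2 + 1)` if odd. [cite: TomitaSvore2014, §2.2 (the two X stabilizers of a data qubit)] -/
def endLo (q : Fin L × Fin L) : Site 2 :=
  if (q.1.val + q.2.val) % 2 = 0 then spt (((q.1.val : ℤ) + q.2.val) / 2 - 1) (((q.1.val : ℤ) - q.2.val) / 2)
  else spt (((q.1.val : ℤ) + q.2.val - 1) / 2) (((q.1.val : ℤ) - q.2.val - 1) / 2 + 1)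

/-- **The upper end** of the bond of the qubit `(i, j)` (the end with `u - v = j`): `((i+j)/2, (i-j)/2)` if `i + j` is even,
`((i+j-1)/2, (i-j-1)/2)` if odd. [cite: TomitaSvore2014, §2.2 (the two X stabilizers of a data qubit)] -/
def endHi (q : Fin L × Fin L) : Site 2 :=
  if (q.1.val + q.2.val) % 2 = 0 then spt (((q.1.val : ℤ) + q.2.val) / 2) (((q.1.val : ℤ) - q.2.val) / 2)
  else spt (((q.1.val : ℤ) + q.2.val - 1) / 2) (((q.1.val : ℤ) - q.2.val - 1) / 2)

/-- `qbond q = {endLo q, endHi q}`. [cite: TomitaSvore2014, §2.2] -/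
theorem qbond_eq (q : Fin L × Fin L) : qbond q = s(endLo q, endHi q) := by
  unfold qbond endLo endHi
  split_ifs with h
  · rfl
  · exact Sym2.eq_swap

/-- The lower end lies on the diagonal `u - v = j - 1`. [cite: DennisEtAl2002, §3.2] -/
theorem endLo_sub (q : Fin L × Fin L) : endLo q 0 - endLo q 1 = (q.2.val : ℤ) - 1 := by
  unfold endLo
  split_ifs with h <;> rw [spt_sub] <;> omega

/-- The upper end lies on the diagonal `u - v = j`. [cite: DennisEtAl2002, §3.2] -/
theorem endHi_sub (q : Fin L × Fin L) : endHi q 0 - endHi q 1 = (q.2.val : ℤ) := by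
  unfold endHi
  split_ifs with h <;> rw [spt_sub] <;> omega

/-- **For `j ≥ 1` the lower end is the site of a valid face** (`(i, j-1)` if `i + j` is even, `(i+1, j-1)` if odd).
[cite: TomitaSvore2014, §2.2 (X stabilizers of the rotated layout)] -/
theorem exists_rsite_eq_endLo (q : Fin L × Fin L) (hj : 1 ≤ q.2.val) :
    ∃ x : Fin (L + 1) × Fin (L - 1), (x.1.val + x.2.val) % 2 = 1 ∧ rsite x = endLo q := by
  obtain ⟨i, j⟩ := q
  unfold rsite endLo
  simp only at hj ⊢
  by_cases h : (i.val + j.val) % 2 = 0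
  · refine ⟨(⟨i.val, by omega⟩, ⟨j.val - 1, by omega⟩), ?_, ?_⟩
    · simp only; omega
    · rw [if_pos h, spt_eq_spt_iff'']; simp only; omega
  · refine ⟨(⟨i.val + 1, by omega⟩, ⟨j.val - 1, by omega⟩), ?_, ?_⟩
    · simp only; omega
    · rw [if_neg h, spt_eq_spt_iff'']; simp only; omega

/-- **For `j ≤ L - 2` the upper end is the site of a valid face** (`(i+1, j)` if `i + j` is even, `(i, j)` if odd).
[cite: TomitaSvore2014, §2.2 (X stabilizers of the rotated layout)] -/
theorem exists_rsite_eq_endHi (q : Fin L × Fin L) (hj : q.2.val + 2 ≤ L) :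
    ∃ x : Fin (L + 1) × Fin (L - 1), (x.1.val + x.2.val) % 2 = 1 ∧ rsite x = endHi q := by
  obtain ⟨i, j⟩ := q
  unfold rsite endHi
  simp only at hj ⊢
  by_cases h : (i.val + j.val) % 2 = 0
  · refine ⟨(⟨i.val + 1, by omega⟩, ⟨j.val, by omega⟩), ?_, ?_⟩
    · simp only; omega
    · rw [if_pos h, spt_eq_spt_iff'']; simp only; omega
  · refine ⟨(⟨i.val, by omega⟩, ⟨j.val, by omega⟩), ?_, ?_⟩
    · simp only; omega
    · rw [if_neg h]

/-- **In column `0` the lower end is the virtual site `vbot i`.** [cite: DennisEtAl2002, §3.2 (rough edge: links with one end off the lattice)] -/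
theorem endLo_eq_vbot (q : Fin L × Fin L) (hj : q.2.val = 0) : endLo q = vbot q.1 := by
  obtain ⟨i, j⟩ := q
  unfold endLo vbot
  simp only at hj ⊢
  by_cases h : (i.val + j.val) % 2 = 0
  · rw [if_pos h, if_pos (by omega), spt_eq_spt_iff'']; omega
  · rw [if_neg h, if_neg (by omega), spt_eq_spt_iff'']; omega

/-- **In column `L - 1` the upper end is the virtual site `vtop i`.** [cite: DennisEtAl2002, §3.2 (the opposite rough edge)] -/
theorem endHi_eq_vtop (q : Fin L × Fin L) (hj : q.2.val = L - 1) : endHi q = vtop q.1 := by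
  obtain ⟨i, j⟩ := q
  have hL : 1 ≤ L := by have := j.2; omega
  unfold endHi vtop
  simp only at hj ⊢
  by_cases h : (i.val + j.val) % 2 = 0
  · rw [if_pos h, if_pos (by omega), spt_eq_spt_iff'']; omega
  · rw [if_neg h, if_neg (by omega), spt_eq_spt_iff'']; omega

/-! ### Sites for ALL faces -/

/-- **The site of a face**: `rsite` for the valid faces (`a' + b` odd); the faces of the wrong colour (zero rows of `H_X`) are
parked at `(a', a'+b+2)`, on the diagonals `u - v ≤ -2` off the strip. [cite: TomitaSvore2014, §2.2 (the X stabilizers of the rotated layout)] -/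
def fsite (x : Fin (L + 1) × Fin (L - 1)) : Site 2 :=
  if (x.1.val + x.2.val) % 2 = 1 then rsite x else spt x.1.val ((x.1.val : ℤ) + x.2.val + 2)

/-- `fsite = rsite` on valid faces. [cite: TomitaSvore2014, §2.2] -/
theorem fsite_of_valid {x : Fin (L + 1) × Fin (L - 1)} (hx : (x.1.val + x.2.val) % 2 = 1) : fsite x = rsite x := by
  unfold fsite; rw [if_pos hx]

/-- Parked faces lie on `u - v = -(b+2) ≤ -2`. [cite: TomitaSvore2014, §2.2] -/
theorem fsite_sub_of_invalid {x : Fin (L + 1) × Fin (L - 1)} (hx : ¬ (x.1.val + x.2.val) % 2 = 1) :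
    fsite x 0 - fsite x 1 = -((x.2.val : ℤ) + 2) := by
  unfold fsite; rw [if_neg hx, spt_sub]; ring

/-- Every face site lies off the two rough diagonals and, if on the strip, strictly inside: `u - v ∉ {-1, L-1}`.
[cite: DennisEtAl2002, §3.2 (the checks lie between the two rough edges)] -/
theorem fsite_sub_ne (x : Fin (L + 1) × Fin (L - 1)) : fsite x 0 - fsite x 1 ≠ -1 ∧ fsite x 0 - fsite x 1 ≠ (L : ℤ) - 1 := by
  have hb := x.2.2
  by_cases hx : (x.1.val + x.2.val) % 2 = 1
  · rw [fsite_of_valid hx, rsite_sub_eq hx]; omega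
  · rw [fsite_sub_of_invalid hx]; omega

/-- **`fsite` is injective.** [cite: TomitaSvore2014, §2.2 (distinct stabilizers)] -/
theorem fsite_injective : Function.Injective (fsite (L := L)) := by
  intro x x' h
  by_cases hx : (x.1.val + x.2.val) % 2 = 1 <;> by_cases hx' : (x'.1.val + x'.2.val) % 2 = 1
  · rw [fsite_of_valid hx, fsite_of_valid hx'] at h
    exact rsite_injOn hx hx' h
  · exfalso
    have h1 := rsite_sub_eq hx
    have h2 := fsite_sub_of_invalid hx'
    rw [← fsite_of_valid hx, h] at h1
    omega
  · exfalso
    have h1 := fsite_sub_of_invalid hx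
    have h2 := rsite_sub_eq hx'
    rw [h, fsite_of_valid hx'] at h1
    omega
  · unfold fsite at h
    rw [if_neg hx, if_neg hx', spt_eq_spt_iff''] at h
    obtain ⟨a, b⟩ := x
    obtain ⟨a', b'⟩ := x'
    simp only [Prod.mk.injEq, Fin.ext_iff] at h ⊢
    omega

/-! ### The drawing -/

open Classical in
/-- ★ **The `H_X` sector of `RSC(L)` as a check matrix drawn on `ℤ²`** (all faces, zero rows parked off the strip): sites
`fsite`, bonds `qbond`, bottom / top virtual sites `vbot` / `vtop` (the rough edges `u - v = -1`, `u - v = L-1`), and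
`bot (i, j) = [j = 0]` (a bond dangles from the bottom edge iff its qubit is in column `0`).
[cite: DennisEtAl2002, §3.2 (planar codes: rough edges)] [cite: TomitaSvore2014, §2.2 (the rotated layout)] -/
def rscDrawing (L : ℕ) : CheckDrawing (HX L) 2 (Fin L) (Fin L) where
  site := fsite
  bond := qbond
  vb := vbot
  vt := vtop
  bot q := if q.2.val = 0 then 1 else 0
  site_injective := fsite_injective
  bond_injective := qbond_injective
  adj_of_bond_eq q P P' h := zdGraph_adj_of_qbond_eq q h
  apply_eq_ite x q := by
    by_cases hx : (x.1.val + x.2.val) % 2 = 1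
    · rw [HX_apply_eq_ite_of_valid hx, fsite_of_valid hx]
    · rw [HX_eq_zero_of_invalid x hx, Pi.zero_apply, if_neg]
      intro hm
      rw [qbond_eq, Sym2.mem_iff] at hm
      have h0 := fsite_sub_of_invalid hx
      rcases hm with hm | hm
      · have := endLo_sub q; rw [← hm] at this; omega
      · have := endHi_sub q; rw [← hm] at this; omega
  site_ne_vb x i h := by
    have h1 := (fsite_sub_ne x).1
    rw [h, vbot_sub] at h1
    exact h1 rfl
  site_ne_vt x i h := by
    have hL : 1 ≤ L := by have := i.2; omega
    have h1 := (fsite_sub_ne x).2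
    rw [h, vtop_sub hL] at h1
    exact h1 rfl
  vb_ne_vt i i' h := by
    have hL : 1 ≤ L := by have := i.2; omega
    have h1 := vbot_sub i
    rw [h, vtop_sub hL] at h1
    omega
  ends_cases q P hP := by
    rw [qbond_eq, Sym2.mem_iff] at hP
    have hj := q.2.2
    rcases hP with rfl | rfl
    · by_cases hj0 : q.2.val = 0
      · exact Or.inr (Or.inl ⟨q.1, (endLo_eq_vbot q hj0).symm⟩)
      · obtain ⟨x, hx, hxe⟩ := exists_rsite_eq_endLo q (by omega)
        exact Or.inl ⟨x, by rw [← hxe]; exact fsite_of_valid hx⟩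
    · by_cases hjL : q.2.val = L - 1
      · exact Or.inr (Or.inr ⟨q.1, (endHi_eq_vtop q hjL).symm⟩)
      · obtain ⟨x, hx, hxe⟩ := exists_rsite_eq_endHi q (by omega)
        exact Or.inl ⟨x, by rw [← hxe]; exact fsite_of_valid hx⟩
  bot_eq q P P' h := by
    have hHi : ¬ ∃ i : Fin L, vbot i = endHi q := by
      rintro ⟨i, hi⟩
      have h1 := vbot_sub i
      rw [hi, endHi_sub] at h1
      omega
    rw [qbond_eq, Sym2.eq_iff] at h
    by_cases hj0 : q.2.val = 0
    · have hLo : ∃ i : Fin L, vbot i = endLo q := ⟨q.1, (endLo_eq_vbot q hj0).symm⟩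
      rcases h with ⟨rfl, rfl⟩ | ⟨rfl, rfl⟩
      · simp only [hj0, hLo, hHi, if_true, if_false, add_zero]
      · simp only [hj0, hLo, hHi, if_true, if_false, zero_add]
    · have hLo : ¬ ∃ i : Fin L, vbot i = endLo q := by
        rintro ⟨i, hi⟩
        have h1 := vbot_sub i
        rw [hi, endLo_sub] at h1
        omega
      rcases h with ⟨rfl, rfl⟩ | ⟨rfl, rfl⟩
      · simp only [hj0, hLo, hHi, if_false, add_zero]
      · simp only [hj0, hLo, hHi, if_false, add_zero]

/-- **Height gap `L`**: the height `u - v` is `-1` on the bottom rough edge and `L - 1` on the top one, and changes by `±1`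
along every unit vector of `ℤ²` (`L ≥ 1`). [cite: DennisEtAl2002, §5.2 ("homologically nontrivial (self-avoiding) path must contain at least L links")] -/
theorem rscDrawing_heightGap (hL : 1 ≤ L) : (rscDrawing L).HeightGap L := by
  refine ⟨Pi.evalAddMonoidHom (fun _ : Fin 2 => ℤ) 0 - Pi.evalAddMonoidHom (fun _ : Fin 2 => ℤ) 1, -1, fun i => ?_,
    fun b => ?_, fun t => ?_⟩
  · fin_cases i <;> simp
  · show vbot b 0 - vbot b 1 = -1
    exact vbot_sub b
  · show vtop t 0 - vtop t 1 = -1 + (L : ℤ)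
    rw [vtop_sub hL]; ring

/-- **The bottom crossing number is the column-`0` parity**: `Σ_q c(q)·bot(q) = Σ_i c(i, 0)`.
[cite: DennisEtAl2002, §3.2 (a relative cycle crosses the rough edge)] -/
theorem sum_mul_rscDrawing_bot (hL : 0 < L) (c : Fin L × Fin L → ZMod 2) :
    ∑ q, c q * (rscDrawing L).bot q = ∑ i : Fin L, c (i, ⟨0, hL⟩) := by
  simp only [rscDrawing, Fintype.sum_prod_type, mul_ite, mul_one, mul_zero]
  refine Finset.sum_congr rfl fun i _ => ?_
  rw [Finset.sum_eq_single (⟨0, hL⟩ : Fin L)]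
  · simp
  · intro j _ hj
    exact if_neg fun h => hj (Fin.ext h)
  · intro h; exact absurd (Finset.mem_univ _) h

/-! ### The space-time counting bound for the `H_X` sector of `RSC(L)` -/

open Classical in
/-- ★ **DKLP's counting bound for the rotated surface code with NOISY syndrome measurement** (`H_X` sector, `L ≥ 1`, `T` rounds,
TWO RATES: qubit faults at rate `p`, measurement faults at rate `q`, `0 ≤ p, q ≤ ρ ≤ 1/2`): for a minimum-weight space-time
decoder `D` and a walk count `cₙ(ℤ³) ≤ C νⁿ` with `r = 2ν√(ρ(1-ρ)) < 1`, the total probability of the histories whose residual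
projects to a chain with an odd number of column-`0` qubits is at most `L·T·C·r^L/(1-r)` (`L·T` bottom rough space-time sites
to start a relative polygon from). [cite: DennisEtAl2002, §5.2 eqs. (saw_prob), (saw_L), §5.3 eqs. (saw_3), (fail_iso), (threshold_iso_num)] -/
theorem rsc_st_sum_oddResidual_le_twoRate (hL : 0 < L) {C ν : ℝ} (hν : 0 < ν) (hC : ToricCode.SAWCountBound3 C ν) {T : ℕ}
    {D : STDecoder (Fin (L + 1) × Fin (L - 1)) (Fin L × Fin L) T}
    (hD : D.IsMinWeight (stSyn (HX L) T) (stCycles (HX L) T) hammingNorm)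
    {p q ρ : ℝ} (hp0 : 0 ≤ p) (hq0 : 0 ≤ q) (hpρ : p ≤ ρ) (hqρ : q ≤ ρ) (hρ : ρ ≤ 1 / 2)
    (hr1 : 2 * ν * Real.sqrt (ρ * (1 - ρ)) < 1) :
    ∑ E ∈ univ.filter (fun E : History (Fin (L + 1) × Fin (L - 1)) (Fin L × Fin L) T =>
        ∑ i : Fin L, proj (D (stSyn (HX L) T E) + E) (i, ⟨0, hL⟩) = 1), phenomenologicalWeight T p q (supp E) ≤
      (L : ℝ) * T * C * (2 * ν * Real.sqrt (ρ * (1 - ρ))) ^ L / (1 - 2 * ν * Real.sqrt (ρ * (1 - ρ))) := by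
  classical
  have h := (rscDrawing L).spaceTime_sum_oddResidual_le_twoRate T (rscDrawing_heightGap hL) hν hC hD hp0 hq0 hpρ hqρ hρ hr1
  rw [Fintype.card_fin] at h
  refine le_trans (le_of_eq (Finset.sum_congr (Finset.filter_congr fun E _ => ?_) fun _ _ => rfl)) h
  rw [sum_mul_rscDrawing_bot hL]

open Classical in
/-- **The same with equal rates `q = p`** (`0 ≤ p ≤ 1/2`, `r = 2ν√(p(1-p)) < 1`): `≤ L·T·C·r^L/(1-r)`.
[cite: DennisEtAl2002, §5.3 eqs. (saw_3), (fail_iso)] -/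
theorem rsc_st_sum_oddResidual_le (hL : 0 < L) {C ν : ℝ} (hν : 0 < ν) (hC : ToricCode.SAWCountBound3 C ν) {T : ℕ}
    {D : STDecoder (Fin (L + 1) × Fin (L - 1)) (Fin L × Fin L) T}
    (hD : D.IsMinWeight (stSyn (HX L) T) (stCycles (HX L) T) hammingNorm)
    {p : ℝ} (hp0 : 0 ≤ p) (hp : p ≤ 1 / 2) (hr1 : 2 * ν * Real.sqrt (p * (1 - p)) < 1) :
    ∑ E ∈ univ.filter (fun E : History (Fin (L + 1) × Fin (L - 1)) (Fin L × Fin L) T =>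
        ∑ i : Fin L, proj (D (stSyn (HX L) T E) + E) (i, ⟨0, hL⟩) = 1), phenomenologicalWeight T p p (supp E) ≤
      (L : ℝ) * T * C * (2 * ν * Real.sqrt (p * (1 - p))) ^ L / (1 - 2 * ν * Real.sqrt (p * (1 - p))) :=
  rsc_st_sum_oddResidual_le_twoRate hL hν hC hD hp0 hp0 le_rfl le_rfl hp hr1

open Classical in
/-- **The rotated space-time counting bound tends to zero inside the box `p, q ≤ ρ < p₀(ν)`** along `L = i + 1`: under
`cₙ(ℤ³) ≤ C νⁿ`, for every polynomially bounded schedule of rounds `T(i)`, every family of minimum-weight space-time decoders of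
the `H_X` sectors and all rates `0 ≤ p, q ≤ ρ ≤ 1/2` with `4ν² ρ(1-ρ) < 1`: `(i+1)·T(i)·C·r^{i+1}/(1-r) → 0`.
[cite: DennisEtAl2002, §5.3 eqs. (threshold_iso), (fail_iso), (threshold_iso_num) ("with T increasing no faster than a polynomial of L")] -/
theorem rsc_st_tendsto_sum_oddResidual_twoRate {C ν : ℝ} (hν : 0 < ν) (hC : ToricCode.SAWCountBound3 C ν) {Tk : ℕ → ℕ}
    (hT : ToricCode.IsPolyBounded Tk)
    (D : ∀ i : ℕ, STDecoder (Fin (i + 1 + 1) × Fin (i + 1 - 1)) (Fin (i + 1) × Fin (i + 1)) (Tk i))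
    (hD : ∀ i, (D i).IsMinWeight (stSyn (HX (i + 1)) (Tk i)) (stCycles (HX (i + 1)) (Tk i)) hammingNorm)
    {p q ρ : ℝ} (hp0 : 0 ≤ p) (hq0 : 0 ≤ q) (hpρ : p ≤ ρ) (hqρ : q ≤ ρ) (hρ : ρ ≤ 1 / 2)
    (h4 : 4 * ν ^ 2 * (ρ * (1 - ρ)) < 1) :
    Tendsto (fun i => ∑ E ∈ univ.filter (fun E : History (Fin (i + 1 + 1) × Fin (i + 1 - 1)) (Fin (i + 1) × Fin (i + 1))
        (Tk i) => ∑ j : Fin (i + 1), proj (D i (stSyn (HX (i + 1)) (Tk i) E) + E) (j, ⟨0, by omega⟩) = 1),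
        phenomenologicalWeight (Tk i) p q (supp E)) atTop (𝓝 0) := by
  set s := Real.sqrt (ρ * (1 - ρ)) with hs
  set r := 2 * ν * s with hr
  have hs0 : 0 ≤ s := Real.sqrt_nonneg _
  have hr0 : 0 ≤ r := by rw [hr]; positivity
  have hρ0 : 0 ≤ ρ := hp0.trans hpρ
  have hpp : 0 ≤ ρ * (1 - ρ) := mul_nonneg hρ0 (by linarith)
  have hr1 : r < 1 := by
    have hsq : r ^ 2 = 4 * ν ^ 2 * (ρ * (1 - ρ)) := by
      rw [hr, mul_pow, mul_pow, hs, Real.sq_sqrt hpp]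
      ring
    have h : r ^ 2 < 1 := by rw [hsq]; exact h4
    have := (sq_lt_one_iff_abs_lt_one r).1 h
    rwa [abs_of_nonneg hr0] at this
  have h1r : 0 < 1 - r := by linarith
  have hC0 : 0 ≤ C := by
    have h0 := hC 0
    rw [SAW.Zd.count_zero, pow_zero, mul_one, Nat.cast_one] at h0
    linarith
  obtain ⟨A, m, hA⟩ := hT
  have hA0 : 0 ≤ A := by
    have := hA 0
    have h0 : (0 : ℝ) ≤ (Tk 0 : ℝ) := Nat.cast_nonneg _
    simp only [Nat.cast_zero, zero_add, one_pow, mul_one] at this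
    linarith
  have hbound : ∀ i : ℕ, (∑ E ∈ univ.filter (fun E : History (Fin (i + 1 + 1) × Fin (i + 1 - 1)) (Fin (i + 1) × Fin (i + 1))
        (Tk i) => ∑ j : Fin (i + 1), proj (D i (stSyn (HX (i + 1)) (Tk i) E) + E) (j, ⟨0, by omega⟩) = 1),
        phenomenologicalWeight (Tk i) p q (supp E)) ≤
      ((i + 1 : ℕ) : ℝ) * (A * ((i : ℝ) + 1) ^ m) * C * r ^ (i + 1) / (1 - r) := by
    intro i
    refine (rsc_st_sum_oddResidual_le_twoRate (L := i + 1) (by omega) hν hC (hD i) hp0 hq0 hpρ hqρ hρ hr1).trans ?_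
    have hk : (0 : ℝ) ≤ ((i + 1 : ℕ) : ℝ) := by positivity
    have h1 : ((i + 1 : ℕ) : ℝ) * (Tk i : ℝ) * C ≤ ((i + 1 : ℕ) : ℝ) * (A * ((i : ℝ) + 1) ^ m) * C :=
      mul_le_mul_of_nonneg_right (mul_le_mul_of_nonneg_left (hA i) hk) hC0
    exact div_le_div_of_nonneg_right (mul_le_mul_of_nonneg_right h1 (pow_nonneg hr0 _)) h1r.le
  have hnonneg : ∀ i : ℕ, 0 ≤ ∑ E ∈ univ.filter (fun E : History (Fin (i + 1 + 1) × Fin (i + 1 - 1))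
        (Fin (i + 1) × Fin (i + 1)) (Tk i) =>
        ∑ j : Fin (i + 1), proj (D i (stSyn (HX (i + 1)) (Tk i) E) + E) (j, ⟨0, by omega⟩) = 1),
        phenomenologicalWeight (Tk i) p q (supp E) := by
    intro i
    refine Finset.sum_nonneg fun E _ => indepWeight_nonneg (CheckDrawing.phenomRate_nonneg' hp0 hq0) ?_ _
    intro ℓ
    exact (CheckDrawing.phenomRate_le' hpρ hqρ ℓ).trans (by linarith)
  have hlim : Tendsto (fun i : ℕ => ((i + 1 : ℕ) : ℝ) * (A * ((i : ℝ) + 1) ^ m) * C * r ^ (i + 1) / (1 - r))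
      atTop (𝓝 0) := by
    have h0 := tendsto_pow_const_mul_const_pow_of_abs_lt_one (m + 1) (show |r| < 1 by rwa [abs_of_nonneg hr0])
    have h1 : Tendsto (fun i : ℕ => ((i + 1 : ℕ) : ℝ) ^ (m + 1) * r ^ (i + 1)) atTop (𝓝 0) :=
      (Filter.tendsto_add_atTop_iff_nat 1).2 h0
    have h2 := h1.const_mul (A * C / (1 - r))
    rw [mul_zero] at h2
    refine h2.congr fun i => ?_
    have h1r0 : 1 - r ≠ 0 := h1r.ne'
    push_cast
    field_simp
    ring
  exact squeeze_zero hnonneg hbound hlim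

open Classical in
/-- **Equal rates**: the rotated space-time counting bound tends to zero for `q = p`, `0 ≤ p ≤ 1/2`, `4ν² p(1-p) < 1`, along
`L = i + 1` (polynomially many rounds, every family of minimum-weight space-time decoders of the `H_X` sectors).
[cite: DennisEtAl2002, §5.3 eqs. (threshold_iso), (fail_iso)] -/
theorem rsc_st_tendsto_sum_oddResidual {C ν : ℝ} (hν : 0 < ν) (hC : ToricCode.SAWCountBound3 C ν) {Tk : ℕ → ℕ}
    (hT : ToricCode.IsPolyBounded Tk)
    (D : ∀ i : ℕ, STDecoder (Fin (i + 1 + 1) × Fin (i + 1 - 1)) (Fin (i + 1) × Fin (i + 1)) (Tk i))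
    (hD : ∀ i, (D i).IsMinWeight (stSyn (HX (i + 1)) (Tk i)) (stCycles (HX (i + 1)) (Tk i)) hammingNorm)
    {p : ℝ} (hp0 : 0 ≤ p) (hp : p ≤ 1 / 2) (h4 : 4 * ν ^ 2 * (p * (1 - p)) < 1) :
    Tendsto (fun i => ∑ E ∈ univ.filter (fun E : History (Fin (i + 1 + 1) × Fin (i + 1 - 1)) (Fin (i + 1) × Fin (i + 1))
        (Tk i) => ∑ j : Fin (i + 1), proj (D i (stSyn (HX (i + 1)) (Tk i) E) + E) (j, ⟨0, by omega⟩) = 1),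
        phenomenologicalWeight (Tk i) p p (supp E)) atTop (𝓝 0) :=
  rsc_st_tendsto_sum_oddResidual_twoRate hν hC hT D hD hp0 hp0 le_rfl le_rfl hp h4

end RotatedSurface

end Literature.InformationTheory.QuantumCodes
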